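import Summits.QuantumFields.YangMills.Theorems.UnitScaleTiltFluctuationComparisonRegPrRepAtHeightsV3FamBase
import Summits.QuantumFields.YangMills.Theorems.UnitScaleTiltFluctuationComparisonRegPrRepAtHeightsWinRow
import HarnessLib

/-!
# Crux `FluctuationComparisonRegPrL` (stmt-QuantumFields-19935), v3 re-base: conjunct (A) `RepAtHeights` FOR AN ARBITRARY FAMILY OF v3 PACKAGES — part 2:
# the upper one-step trivial envelope from the member's own row `PkgAtV3.fibre55Win … (Hist.triv …)` and **`AlphaInputsT3AC.repAtHeights_dataOfV3`**
# (support file `--supports stmt-QuantumFields-19935`; family-generic edition of p512521, FINDING F-g4-1)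

Fleet seat `ym-ust-19201-p2` (gen 4, v5j pen).  For an ARBITRARY family `p : ∀ K, PkgAtV3 F 𝔠 γ hγ hγ1 K` of admissible v3 packages (not only the `Classical.choice` one
behind `OfV3At.dataT3v3`) and `D := AlphaInputsT3AC.dataOfV3 p π`:
* §1 `dataOfV3_oneStepUpperTrivAt` — the upper one-step trivial envelope from `(p K).fibre55Win k hk (Hist.triv …)` via `fibre55Triv_of_fibre55WinAC` (p506937), the exponent step
  `(p K).expo_succ` at `triv′`, homogeneity of the transport for `e^{E}`, the window dictionary (p512521's proof over `p K`);
* §2 **`repAtHeights_dataOfV3`** — `RepAtHeights D 𝔠.b₀ 𝔠.p₀ ε₀` under `hp : ∀ K, (p K).a₀ = a₀ ∧ (p K).a₁ = a₁` and the adapter's thresholds; and the choice instance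
  `OfV3At.repAtHeights_dataT3v3'` recovered by `rfl` (= p512521's theorem, documented for the re-cut STUB 3″ of v5j′ which reads `dataOfV3` of an ∃-quantified family).
Nothing of Bałaban's is asserted; CONDITIONAL only on the family `p`.

References: T. Bałaban, CMP 102 (1985) 255–275 [Balaban1985UV3] ((41) p.266, (47)–(49) pp.267–268, (55)–(58) pp.269–270, Thm 2 p.272, p.272 L32–33);
CMP 102 (1985) 277–309 [Balaban1985Variational] (Thm 1 (8) p.279).
-/

set_option autoImplicit false

noncomputable section

namespace Summit.QuantumFields.YangMills.Theorems

open MeasureTheory Filter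
open Literature.MathematicalPhysics.QuantumFieldTheory.Balaban1983to89
open Literature.MathematicalPhysics.QuantumFieldTheory.Balaban1983to89.B10
open Literature.MathematicalPhysics.QuantumFieldTheory.Balaban1983to89.B10SectAGathering
open Literature.MathematicalPhysics.QuantumFieldTheory.Balaban1983to89.AveragingRT (rnTransport)
open Literature.MathematicalPhysics.QuantumFieldTheory.Balaban1983to89.T3ContinuumYM3Torus
open Literature.MathematicalPhysics.QuantumFieldTheory.Balaban1983to89.T3UnitLawDensityEML (ℰp rt)
open Literature.MathematicalPhysics.QuantumFieldTheory.Balaban1983to89.T3UnitScaleTilt (θBal)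
open Literature.MathematicalPhysics.QuantumFieldTheory.Balaban1983to89.T3LevelShift (fieldShift)
open Literature.MathematicalPhysics.QuantumFieldTheory.Balaban1983to89.T3PrintedRegularMinimiser
open Literature.MathematicalPhysics.QuantumFieldTheory.Balaban1983to89.T3AlphaInputsAC
open Literature.MathematicalPhysics.QuantumFieldTheory.Balaban1983to89.T3AlphaInputsACTrivEnvelope
open Literature.MathematicalPhysics.QuantumFieldTheory.Balaban1985CMP102
open Literature.MathematicalPhysics.QuantumFieldTheory.Balaban1985CMP102.Setting
open Summit.QuantumFields.Balaban3D.Carriers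
open Summit.QuantumFields.Balaban3D.Proofs.Primitives
open Summit.QuantumFields.Balaban3D.Proofs.TowerAC
open Summit.QuantumFields.Balaban3D.Proofs.StandardAC
open Summit.QuantumFields.Balaban3D.Proofs.InputsAC
open Summit.QuantumFields.Balaban3D.Proofs.Bound55AC
open Summit.QuantumFields.Balaban3D.Proofs.Bound55Masses (chiB chiB_nonneg chiB_le_one measurable_chiB)
open Summit.QuantumFields.Balaban3D.Proofs (Bound55Std.measurable_actionEta Bound55Std.actionEta_nonneg)
open Summit.QuantumFields.YangMills.Theorems.LogComparisonRepAtHeights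

/-! ## §1 The upper one-step trivial envelope of the v3 datum from the package's own trivial-history row -/

section Upper

variable {F : T3Family} {𝔠 : AlphaConsts F.L (suGroupModel 2).N} {γ : ℝ} {hγ : 0 < γ} {hγ1 : γ ≤ (min 𝔠.gamma0 1) ^ 2}
  (p : ∀ K, AlphaInputsT3AC.PkgAtV3 F 𝔠 γ hγ hγ1 K) (π : AlphaInputsT3AC.PolymerT3 F)

open Classical in
/-- **THE UPPER ONE-STEP TRIVIAL ENVELOPE OF THE FAMILY DATUM — PROVED FROM THE MEMBER'S OWN ROWS**: for every run `K` and step `k < K`,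
`OneStepUpperTrivAt (dataT3v3 …) 𝔠.b₀ 𝔠.p₀ K k` — the row `PkgAtV3.fibre55Win k hk (Hist.triv …)` at the trivial new history (mass-free by
`fibre55Triv_of_fibre55WinAC`), the exponent step `PkgAtV3.expo_succ` at `triv′`, homogeneity of the transport for `e^{E}`, and the window dictionary.
[cite: Balaban1985UV3, (41) p.266 and (55)-(58) pp.269-270] -/
theorem AlphaInputsT3AC.dataOfV3_oneStepUpperTrivAt (K k : ℕ) (hk : k + 1 ≤ K) :
    OneStepUpperTrivAt (AlphaInputsT3AC.dataOfV3 p π) 𝔠.b₀ 𝔠.p₀ K k hk := by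
  -- the package's data of run `K`, its v3 step row at `k` at the trivial new history (mass-free form), the exponent step
  have st := (p K).run.steps k hk
  have hkm : k + 1 ≤ F.m + K := by omega
  have hkm' : k ≤ (F.P K).m + (F.P K).K := by
    show k ≤ F.m + K
    omega
  have h49 := fibre55Triv_of_fibre55WinAC 𝔠.lane (p K).X (p K).𝔖
    (AlphaInputsT3AC.admWindowT3 F 𝔠 γ hγ hγ1 K) k hkm' ((p K).fibre55Win k hk (Hist.triv (F.P K) (k + 1)))
    (fun U hU => AlphaInputsT3AC.wtP_admWindowT3_triv_eq_one hγ1 (p K).X k (by omega) U hU)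
  have hgath := fun U => (p K).expo_succ k hk (Hist.triv (F.P K) (k + 1)) U
  -- abbreviations in the tower's letters
  let T : TowerRun := (p K).T
  let E : ℝ := (p K).E
  let Pc := piecesAC 𝔠.lane (p K).X (p K).𝔖 k
  let S₃ := T3Scales F γ hγ (hγ1.trans (sq_min_one_le _ 𝔠.gamma0_pos)) K
  -- the averaging of the package IS the route's
  have hav : ∀ j, j + 1 ≤ F.m + K → ((p K).X).av j = BlockAveraging.blockAvg (P := F.P K) (j := j) ℰp :=
    fun j hj => avT3_of_le F K hj
  have hrtT : ∀ g : GaugeField (F.P K) k (Matrix.specialUnitaryGroup (Fin 2) ℂ) → ℝ,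
      (rt F K k hkm).T g = rnTransport (((p K).X).av k).avg g := fun g => by
    rw [hav k hkm]; rfl
  have hε1 : eps1Of S₃ 𝔠.lane.carrier k = θBal F.L γ 𝔠.b₀ 𝔠.p₀ (K - k) :=
    (p K).eps1_eq k (by omega)
  -- the (41)-trivial integrand and its relation to the upper envelope of the datum
  let g : GaugeField (F.P K) k (Matrix.specialUnitaryGroup (Fin 2) ℂ) → ℝ := fun U =>
    Real.exp (-(T.mainT k (T.triv k) U) + T.Pint k (T.triv k) U - T.Ecst k + T.Zterm k (T.triv k) + T.Rm k)
  have hZk : T.Zterm k (T.triv k) = 0 := T.Zterm_triv k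
  have hup_eq : ∀ U, upperTriv (AlphaInputsT3AC.dataOfV3 p π) K k U = Real.exp E * g U := by
    intro U
    rw [upperTriv_eq_exp]
    show Real.exp ((-(T.mainT k (T.triv k) U) + T.Pint k (T.triv k) U - (T.Ecst k - E)) + T.Rm k) =
      Real.exp E * Real.exp (-(T.mainT k (T.triv k) U) + T.Pint k (T.triv k) U - T.Ecst k + T.Zterm k (T.triv k) + T.Rm k)
    rw [hZk, ← Real.exp_add]
    congr 1
    ring
  -- the window weight of the AC tower at the trivial new history
  let χ : GaugeField (F.P K) k (Matrix.specialUnitaryGroup (Fin 2) ℂ) → ℝ := fun U =>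
    chiB 𝔠.lane.carrier.M₁ (rcolOf S₃ 𝔠.lane.carrier) (eps1Of S₃ 𝔠.lane.carrier) k (Hist.triv (F.P K) (k + 1)) U
  let cg : GaugeField (F.P K) k (Matrix.specialUnitaryGroup (Fin 2) ℂ) → ℝ := fun U => χ U * g U
  -- the (49)-factor at the trivial new history IS the window indicator of level `k`
  have hchiB : ∀ (f : GaugeField (F.P K) k (Matrix.specialUnitaryGroup (Fin 2) ℂ) → ℝ) (U : GaugeField (F.P K) k (Matrix.specialUnitaryGroup (Fin 2) ℂ)),
      χ U * f U = {W' : GaugeField (F.P K) k (Matrix.specialUnitaryGroup (Fin 2) ℂ) | PlaqSmall (θBal F.L γ 𝔠.b₀ 𝔠.p₀ (K - k)) W'}.indicator f U := by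
    intro f U
    have e : χ U = if PlaqSmall (eps1Of S₃ 𝔠.lane.carrier k) U then 1 else 0 :=
      Balaban3D.Proofs.FibreClash.chiB_triv_eq (S := S₃) k 𝔠.lane.carrier.M₁ (rcolOf S₃ 𝔠.lane.carrier) (eps1Of S₃ 𝔠.lane.carrier) U
    rw [e, hε1]
    by_cases hU : PlaqSmall (θBal F.L γ 𝔠.b₀ 𝔠.p₀ (K - k)) U
    · rw [if_pos hU, one_mul, Set.indicator_of_mem (show U ∈ {W' | PlaqSmall (θBal F.L γ 𝔠.b₀ 𝔠.p₀ (K - k)) W'} from hU)]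
    · rw [if_neg hU, zero_mul, Set.indicator_of_notMem (show U ∉ {W' | PlaqSmall (θBal F.L γ 𝔠.b₀ 𝔠.p₀ (K - k)) W'} from hU)]
  -- integrability of `χ·g`
  have hmain : ∀ U, T.mainT k (T.triv k) U = (S₃.gk k)⁻¹ ^ 2 * S₃.actionEta k ((p K).UkH k (Hist.triv (F.P K) k) U) :=
    fun _ => rfl
  have hgi : Integrable cg (fieldMeasure (F.P K) k (Matrix.specialUnitaryGroup (Fin 2) ℂ)) := by
    refine Balaban3D.Proofs.Transport48.integrable_weight_mul_exp (measurable_chiB _ _ _ k _) (chiB_nonneg _ _ _ k _) (chiB_le_one _ _ _ k _)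
      ?_ (c := (p K).𝔄.cP k - T.Ecst k + T.Zterm k (T.triv k) + T.Rm k) ?_
    · simp_rw [hmain]
      exact ((((measurable_const.mul ((Bound55Std.measurable_actionEta (S := S₃) k).comp (st.hU _))).neg.add (st.hPm _)).sub
        measurable_const).add measurable_const).add measurable_const
    · intro U
      have h0 : 0 ≤ T.mainT k (T.triv k) U := by
        rw [hmain]; exact mul_nonneg (sq_nonneg _) (Bound55Std.actionEta_nonneg (S := S₃) k _)
      have h2 : T.Pint k (T.triv k) U ≤ (p K).𝔄.cP k := st.hPb _ U
      linarith
  -- homogeneity for the route normalisation `e^{E}`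
  have hhom := rnTransport_const_mul_ae (((p K).X).av k).avg cg
    (fun U => mul_nonneg (chiB_nonneg _ _ _ k _ U) (Real.exp_pos _).le) hgi (Real.exp_nonneg E)
  -- the restricted upper envelope of level `k` IS `e^{E}·χ·g`
  have hind : {W' : GaugeField (F.P K) k (Matrix.specialUnitaryGroup (Fin 2) ℂ) | PlaqSmall (θBal F.L γ 𝔠.b₀ 𝔠.p₀ (K - k)) W'}.indicator
      (upperTriv (AlphaInputsT3AC.dataOfV3 p π) K k) = fun U => Real.exp E * cg U := by
    funext U
    rw [← hchiB _ U, hup_eq U]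
    show χ U * (Real.exp E * g U) = Real.exp E * (χ U * g U)
    ring
  -- the goal
  show ∀ᵐ W ∂fieldMeasure (F.P K) (k + 1) (Matrix.specialUnitaryGroup (Fin 2) ℂ),
    PlaqSmall (θBal F.L γ 𝔠.b₀ 𝔠.p₀ (K - (k + 1))) W →
      (rt F K k hkm).T ({W' : GaugeField (F.P K) k (Matrix.specialUnitaryGroup (Fin 2) ℂ) |
          PlaqSmall (θBal F.L γ 𝔠.b₀ 𝔠.p₀ (K - k)) W'}.indicator (upperTriv (AlphaInputsT3AC.dataOfV3 p π) K k)) W ≤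
        upperTriv (AlphaInputsT3AC.dataOfV3 p π) K (k + 1) W
  rw [hind, hrtT]
  filter_upwards [h49, hhom] with W h49W hhomW
  intro _
  have hup1 : upperTriv (AlphaInputsT3AC.dataOfV3 p π) K (k + 1) W =
      Real.exp E * Real.exp (-(T.mainT (k + 1) (T.triv (k + 1)) W) + T.Pint (k + 1) (T.triv (k + 1)) W - T.Ecst (k + 1)
        + T.Zterm (k + 1) (T.triv (k + 1)) + T.Rm (k + 1)) := by
    rw [upperTriv_eq_exp, T.Zterm_triv (k + 1)]
    show Real.exp ((-(T.mainT (k + 1) (T.triv (k + 1)) W) + T.Pint (k + 1) (T.triv (k + 1)) W - (T.Ecst (k + 1) - E)) + T.Rm (k + 1)) = _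
    rw [← Real.exp_add]
    congr 1
    ring
  have key : rnTransport (((p K).X).av k).avg cg W ≤
      Real.exp (-(T.mainT (k + 1) (T.triv (k + 1)) W) + T.Pint (k + 1) (T.triv (k + 1)) W - T.Ecst (k + 1)
        + T.Zterm (k + 1) (T.triv (k + 1)) + T.Rm (k + 1)) :=
    calc rnTransport (((p K).X).av k).avg cg W
        ≤ Real.exp (-(T.mainT (k + 1) (T.triv (k + 1)) W) - T.Ecst k
              + (Pc.logσ₀ + Pc.dg * Real.log (T.g k)) * Pc.starB (T.triv (k + 1)) + Pc.logZU (T.triv (k + 1)) W + Pc.Pold (T.triv (k + 1)) W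
              + T.Zterm k (Pc.proj (T.triv (k + 1))) + T.Rm k + Pc.logFl (T.triv (k + 1)) W) := h49W
      _ ≤ Real.exp (-(T.mainT (k + 1) (T.triv (k + 1)) W) + T.Pint (k + 1) (T.triv (k + 1)) W - T.Ecst (k + 1)
              + T.Zterm (k + 1) (T.triv (k + 1)) + T.Rm (k + 1)) := Real.exp_le_exp.mpr (hgath W)
  rw [hup1]
  calc rnTransport (((p K).X).av k).avg (fun U => Real.exp E * cg U) W
      = Real.exp E * rnTransport (((p K).X).av k).avg cg W := hhomW
    _ ≤ Real.exp E * Real.exp (-(T.mainT (k + 1) (T.triv (k + 1)) W) + T.Pint (k + 1) (T.triv (k + 1)) W - T.Ecst (k + 1)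
        + T.Zterm (k + 1) (T.triv (k + 1)) + T.Rm (k + 1)) := mul_le_mul_of_nonneg_left key (Real.exp_nonneg E)

end Upper

/-! ## §2 Conjunct (A) at the v3 datum from the v3 package alone -/

section Assembly

variable {F : T3Family} {𝔠 : AlphaConsts F.L (suGroupModel 2).N} {γ : ℝ} {hγ : 0 < γ} {hγ1 : γ ≤ (min 𝔠.gamma0 1) ^ 2}
  (p : ∀ K, AlphaInputsT3AC.PkgAtV3 F 𝔠 γ hγ hγ1 K) (π : AlphaInputsT3AC.PolymerT3 F)

/-- **CONJUNCT (A) OF STUB 3′ FOR AN ARBITRARY FAMILY OF v3 PACKAGES**: for every family `p` whose members carry the given [7]-constants (`hp`) and the adapter's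
thresholds on the coupling, `RepAtHeights (dataOfV3 p π) 𝔠.b₀ 𝔠.p₀ ε₀` — [Balaban1985UV3] (41) ∧ (47) at the trivial history for the RESTRICTED height densities of the `ℰp` runs, two-sided with
slack `Rm`, read at the record's own p-function.  No extra row, no Haar compatibility, no floored mass. [cite: Balaban1985UV3, (41) p.266, (47) p.267 and Thm 2 p.272] -/
theorem AlphaInputsT3AC.repAtHeights_dataOfV3 {a₀ a₁ : ℝ} (hp : ∀ K, (p K).a₀ = a₀ ∧ (p K).a₁ = a₁) (ε₀ : ℝ) (hε : 0 < ε₀) (hhi : ε₀ ≤ a₀)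
    (ha₁ : ∀ n, θBal F.L γ 𝔠.b₀ 𝔠.p₀ n ≤ a₁) (hlo : ∀ n, 𝔠.B₃ * θBal F.L γ 𝔠.b₀ 𝔠.p₀ n ≤ ε₀)
    (h4 : ∀ n, 4 * θBal F.L γ 𝔠.b₀ 𝔠.p₀ n < ε₀) :
    RepAtHeights (AlphaInputsT3AC.dataOfV3 p π) 𝔠.b₀ 𝔠.p₀ ε₀ :=
  repAtHeights_of_oneStepTriv hγ.le
    ⟨AlphaInputsT3AC.dataOfV3_baseTrivAt p π,
      fun K j hjK => ⟨AlphaInputsT3AC.dataOfV3_oneStepLowerTrivAt p π K j hjK, AlphaInputsT3AC.dataOfV3_oneStepUpperTrivAt p π K j hjK⟩,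
      AlphaInputsT3AC.dataOfV3_trivExpIntegrable p π⟩
    (AlphaInputsT3AC.dataOfV3_mainTermAtHeights p π hp ε₀ hε hhi ha₁ hlo h4) (AlphaInputsT3AC.dataOfV3_rmSize p π)


/-- The choice instance: p512521's `OfV3At.repAtHeights_dataT3v3` IS `repAtHeights_dataOfV3` at the chosen family (the datum agrees by `rfl`,
`OfV3At.dataT3v3_eq_dataOfV3`; the chosen members carry the given constants by `pkgAtV3_a₀/a₁`). [cite: Balaban1985UV3, Thm 2 p.272] -/
example {a₀ a₁ : ℝ} (h : AlphaInputsT3AC.OfV3At F 𝔠 a₀ a₁) (hc : 0 < a₀ ∧ 0 < a₁ ∧ 𝔠.B₃ * a₁ ≤ a₀) (ε₀ : ℝ) (hε : 0 < ε₀) (hhi : ε₀ ≤ a₀)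
    (ha₁ : ∀ n, θBal F.L γ 𝔠.b₀ 𝔠.p₀ n ≤ a₁) (hlo : ∀ n, 𝔠.B₃ * θBal F.L γ 𝔠.b₀ 𝔠.p₀ n ≤ ε₀)
    (h4 : ∀ n, 4 * θBal F.L γ 𝔠.b₀ 𝔠.p₀ n < ε₀) :
    RepAtHeights (h.dataT3v3 hc γ hγ hγ1 π) 𝔠.b₀ 𝔠.p₀ ε₀ :=
  AlphaInputsT3AC.repAtHeights_dataOfV3 (fun K => h.pkgAtV3 hc γ hγ hγ1 K) π
    (fun K => ⟨h.pkgAtV3_a₀ hc γ hγ hγ1 K, h.pkgAtV3_a₁ hc γ hγ hγ1 K⟩) ε₀ hε hhi ha₁ hlo h4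

end Assembly

end Summit.QuantumFields.YangMills.Theorems

end
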